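import Mathlib
import Summits.NavierStokesRegularity.NavierStokesRegularity.Theorems.LerayQuarterDissipationFiniteDissipationLiouvilleCriticalProductionCredit
import Summits.NavierStokesRegularity.NavierStokesRegularity.Theorems.LerayQuarterDissipationRecurrentReductionDScaling
import HarnessLib

/-!
# Route `LerayQuarterDissipation`, crux `FiniteDissipationLiouville` (stmt-NavierStokesRegularity-22144), line `birth` —
# THE BORDERLINE ROW UNDER THE DISSIPATION LAW: if `t²|ω|²` is a sub-solution, a finite-dissipation profile is trivial

Seat ns-lqd-lead g18 (LEAD of 22144, cell ns-idea-3; helper `--supports` 22144).  The family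
`…CriticalProductionCredit.eq_zero_of_critical_production_credit` (`a < 1`) stops at the borderline `a = 1`:
`(−t)(⟪ω, DV ω⟫ − |∇ω|²_F) ≤ |ω|²` everywhere says exactly that the scale-invariant enstrophy density `Q = t²|ω|²` is
a SUB-SOLUTION of `∂ₜQ + DQ(V) − ΔQ ≤ 0`, and the hot spot + strong maximum principle then only produce an extremal
`W` with `Q_W ≡ M > 0` on a slab, i.e. `|ω_W(t, ·)| ≡ √M/(−t)` constant in space — which the bare class does not
visibly exclude.  The crux's class carries the route's DISSIPATION LAW `∫|∇V(s)|² ≤ K/√(−s)`, and a slice with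
`|curl W|² ≡ 4M/9 > 0` has infinite dissipation.  Since the law is translation- and scale-invariant and closed under
the class limits (`…RecurrentReductionDScaling.dissipationLaw_nsRescale / dissipationLaw_of_tendsto_fderiv`), it
rides along in the hot-spot property:

* `eq_zero_of_enstrophy_subsolution_of_law` — **a KNSS-gauge Type-I field with the dissipation law and
  `(−t)(⟪ω, DV ω⟫ − |∇ω|²_F) ≤ |ω|²` at every point of `t < 0` vanishes identically** (no envelope).  This single row
  contains, on the crux's class 𝒟, both the stretching-form local balance (`…LocalBalanceStretching`: rate `¼`,
  credit `1`, envelope) and the credit family (`…CriticalProductionCredit`: rate `1`, credit `a < 1`).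
* PORTRAIT `subsolution_fails_of_ne_zero` / `_of_singular` — a non-zero (a fortiori singular) element of 𝒟 has a
  point where `|ω|² < (−t)(⟪ω, DV ω⟫ − |∇ω|²_F)`, i.e. where `t²|ω|²` is strictly super-caloric along the flow.

WHAT THIS IS NOT: not a claim about Navier–Stokes regularity and not the crux — the maximal pointwise production row
of the portrait of the hypothetical minimal ancient element (bears_on LADDER-NS N0).
-/

noncomputable section

-- the summit and its single sub-problem share the name (CONVENTIONS §1), as in every Theorems file
set_option linter.dupNamespace false

namespace Summit.NavierStokesRegularity.NavierStokesRegularity.Theorems.FiniteDissipationLiouville.CriticalProduction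

open MeasureTheory Set Function Filter Topology TopologicalSpace Metric InnerProductSpace
open scoped RealInnerProductSpace InnerProductSpace Laplacian ContDiff ENNReal
open Literature.Analysis Literature.Analysis.FluidPDE
open Summit.NavierStokesRegularity.NavierStokesRegularity.Theorems
open Summit.NavierStokesRegularity.NavierStokesRegularity.Theorems.RecurrentReductionD
open Summit.NavierStokesRegularity.NavierStokesRegularity.Theorems.LocalSineTubeDoorProfileAlignedWindowRigidityAncient
open Summit.NavierStokesRegularity.NavierStokesRegularity.Theorems.PoloidalWindowDoorPoloidalWindowRigidityWindow
open Summit.NavierStokesRegularity.NavierStokesRegularity.Theorems.PoloidalWindowDoorPoloidalWindowRigidityDegenerate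
open Summit.NavierStokesRegularity.NavierStokesRegularity.Theorems.PoloidalWindowDoorPoloidalWindowRigidityFlat
open Summit.NavierStokesRegularity.NavierStokesRegularity.Theorems.PoloidalWindowDoorPoloidalWindowRigidityStrainRate
open Summit.NavierStokesRegularity.NavierStokesRegularity.Theorems.PoloidalWindowDoorPoloidalWindowRigidityPoloidalExtremal
open Summit.NavierStokesRegularity.NavierStokesRegularity.Theorems.PoloidalWindowDoorPoloidalWindowRigidityEnstrophyHotSpot
open Summit.NavierStokesRegularity.NavierStokesRegularity.Theorems.PoloidalWindowDoorPoloidalWindowRigidityStrongMaxPrinciple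
open Summit.NavierStokesRegularity.NavierStokesRegularity.Theorems.PoloidalWindowDoorPoloidalWindowRigidityCriticalProduction
open Summit.NavierStokesRegularity.NavierStokesRegularity.Theorems.FiniteDissipationLiouville.EndpointScheme

variable {C : ℝ} {V : ℝ → EuclideanSpace ℝ (Fin 3) → EuclideanSpace ℝ (Fin 3)}

/-! ### The dissipation law is translation invariant -/

/-- The dissipation law `∫|∇u(s)|² ≤ K/√(−s)` is invariant under spatial translations (Lebesgue measure is).
[folklore] -/
theorem dissipationLaw_translate {K : ℝ} {u : ℝ → EuclideanSpace ℝ (Fin 3) → EuclideanSpace ℝ (Fin 3)}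
    (hlaw : ∀ s : ℝ, s < 0 → ∫⁻ x, ‖fderiv ℝ (u s) x‖ₑ ^ 2 ≤ ENNReal.ofReal (K / Real.sqrt (-s)))
    (x₀ : EuclideanSpace ℝ (Fin 3)) :
    ∀ s : ℝ, s < 0 →
      ∫⁻ x, ‖fderiv ℝ (fun x => u s (x₀ + x)) x‖ₑ ^ 2 ≤ ENNReal.ofReal (K / Real.sqrt (-s)) := by
  intro s hs
  have e : (fun x => ‖fderiv ℝ (fun x => u s (x₀ + x)) x‖ₑ ^ 2) =
      fun x => (fun z => ‖fderiv ℝ (u s) z‖ₑ ^ 2) (x₀ + x) := by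
    funext x; rw [fderiv_translate]
  rw [e, lintegral_add_left_eq_self (fun z => ‖fderiv ℝ (u s) z‖ₑ ^ 2) x₀]
  exact hlaw s hs

/-! ### The borderline row under the law -/

/-- **IF `t²|ω|²` IS A SUB-SOLUTION, A FINITE-DISSIPATION KNSS TYPE-I FIELD IS TRIVIAL.**  `IsTypeIAncientMild C V`,
the dissipation law `∫|∇V(s)|² ≤ K/√(−s)` (`s < 0`), and `(−s)(⟪ω, DV ω⟫ − |∇ω|²_F)(s, y) ≤ |ω(s, y)|²` for all
`s < 0`, `y` ⇒ `V ≡ 0` on `t < 0`.  (Hot spot carrying the law; strong maximum principle: `Q_W ≡ M > 0` on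
`[−2, −1) × ℝ³`; the slice `t = −3/2` then has `|curl W|² ≡ 4M/9`, of infinite dissipation — absurd.) [cite: KochNadirashviliSereginSverak2009, Prop. 4.1 (arXiv:0709.3599)] -/
theorem eq_zero_of_enstrophy_subsolution_of_law {K : ℝ} (hV : IsTypeIAncientMild C V)
    (hlawV : ∀ s : ℝ, s < 0 → ∫⁻ x, ‖fderiv ℝ (V s) x‖ₑ ^ 2 ≤ ENNReal.ofReal (K / Real.sqrt (-s)))
    (hprod : ∀ s < 0, ∀ y, (-s) * (⟪curl (V s) y, fderiv ℝ (V s) y (curl (V s) y)⟫_ℝ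
        - 1 * frobeniusNormSq (fderiv ℝ (curl (V s)) y)) ≤ ⟪curl (V s) y, curl (V s) y⟫_ℝ) :
    ∀ t < 0, ∀ x, V t x = 0 := by
  -- adapted from `eq_zero_of_critical_production_credit` (this line) / `eq_zero_of_critical_production` (nsreg-p7 g5)
  have hrate : HasTypeITimeDecay C V := hV.hasTypeITimeDecay
  have hcont : ContinuousOn (uncurry V) (Iio (0 : ℝ) ×ˢ univ) := hV.continuousOn_uncurry
  have hmild : ∀ s t : ℝ, s < t → t < 0 → ∀ x,
      V t x = UnboundedOperators.heatExtension (V s) (t - s) x - oseenDuhamel 1 s V V t x :=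
    fun s t hst ht x => hV.mild_eq_heatExtension hst ht x
  have hdiv : ∀ t < 0, VectorCalculus.IsDivFree (V t) := fun t ht => hV.isDivFree ht
  refine eq_zero_of_irrotational hrate hcont hmild hdiv fun s₀ hs₀ y₀ => ?_
  by_contra hne
  -- ## the enstrophy hot spot inside the stratum, carrying the law
  obtain ⟨W, M, hW, hPW, hMpos, hle, hmax⟩ := exists_enstrophy_hotSpot
    (P := fun u => (∀ s : ℝ, s < 0 → ∫⁻ x, ‖fderiv ℝ (u s) x‖ₑ ^ 2 ≤ ENNReal.ofReal (K / Real.sqrt (-s))) ∧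
      ∀ s < 0, ∀ y, (-s) * (⟪curl (u s) y, fderiv ℝ (u s) y (curl (u s) y)⟫_ℝ
        - 1 * frobeniusNormSq (fderiv ℝ (curl (u s)) y)) ≤ ⟪curl (u s) y, curl (u s) y⟫_ℝ)
    (fun u x₀ hu => ⟨dissipationLaw_translate hu.1 x₀, critProdCredit_translate x₀ hu.2⟩)
    (fun u c hc hu => ⟨dissipationLaw_nsRescale hu.1 hc, critProdCredit_nsRescale hc hu.2⟩)
    (fun w W' hw hPw _ hpt hgrad => ⟨dissipationLaw_of_tendsto_fderiv (fun k => (hPw k).1) hgrad,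
      critProdCredit_of_limit hw (fun k => (hPw k).2) hpt⟩)
    hV ⟨hlawV, hprod⟩ hs₀ hne
  have hlawW := hPW.1
  have hPW' := hPW.2
  have hWrate : HasTypeITimeDecay C W := hW.hasTypeITimeDecay
  have hWcont : ContinuousOn (uncurry W) (Iio (0 : ℝ) ×ˢ univ) := hW.continuousOn_uncurry
  have hWmild : ∀ s t : ℝ, s < t → t < 0 → ∀ x,
      W t x = UnboundedOperators.heatExtension (W s) (t - s) x - oseenDuhamel 1 s W W t x :=
    fun s t hst ht x => hW.mild_eq_heatExtension hst ht x
  have hWdiv : ∀ t < 0, VectorCalculus.IsDivFree (W t) := fun t ht => hW.isDivFree ht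
  -- ## `Q = t² |ω|²` is a sub-solution on the slab `[−2, −1/2] × ℝ³`
  set q : ℝ → EuclideanSpace ℝ (Fin 3) → ℝ := fun τ y => ⟪curl (W τ) y, curl (W τ) y⟫_ℝ with hqdef
  set Q : ℝ → EuclideanSpace ℝ (Fin 3) → ℝ := fun τ y => τ ^ 2 * q τ y with hQdef
  set Qt : ℝ → EuclideanSpace ℝ (Fin 3) → ℝ := fun τ y => deriv (fun τ' => Q τ' y) τ with hQtdef
  have hg : ∀ τ < (0 : ℝ), HasDerivAt (fun τ : ℝ => τ ^ 2) (2 * τ) τ := fun τ _ => by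
    simpa using hasDerivAt_pow 2 τ
  have hid := fun τ (hτ : τ < 0) y => weightedEnstrophy_identity hWrate hWcont hWmild hWdiv hg hτ y
  have hslab : ∀ t ∈ Icc (-2 : ℝ) (-1 / 2), t < 0 := fun t ht => by linarith [ht.2]
  obtain ⟨B, hB⟩ := bdd_of_hasTypeITimeDecay hWrate (1 / 4) (by norm_num)
  have hbA : ∀ t ∈ Icc (-2 : ℝ) (-1 / 2), ∀ x, ‖W t x‖ ≤ B := fun t ht x => hB t (by linarith [ht.2]) x
  have hsmω : IsSmoothSpaceTimeOn (Iio 0) (vorticity W) :=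
    (show IsSmoothSpaceTimeOn (Iio 0) W from hW.contDiffOn).isSmoothSpaceTimeOn_vorticity isOpen_Iio.uniqueDiffOn
  have hq_c : ContinuousOn (uncurry q) (Icc (-2 : ℝ) (-1 / 2) ×ˢ univ) := by
    have hωc : ContinuousOn (uncurry (vorticity W)) (Icc (-2 : ℝ) (-1 / 2) ×ˢ univ) :=
      hsmω.continuousOn.mono (prod_mono (fun t ht => hslab t ht) Subset.rfl)
    have h : ContinuousOn (fun z => ⟪uncurry (vorticity W) z, uncurry (vorticity W) z⟫_ℝ)
        (Icc (-2 : ℝ) (-1 / 2) ×ˢ univ) := hωc.inner hωc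
    refine h.congr fun z _ => ?_
    simp only [hqdef, uncurry, vorticity_apply]
  have hQ_c : ContinuousOn (uncurry Q) (Icc (-2 : ℝ) (-1 / 2) ×ˢ univ) := by
    have hg1 : ContinuousOn (fun z : ℝ × EuclideanSpace ℝ (Fin 3) => z.1 ^ 2) (Icc (-2 : ℝ) (-1 / 2) ×ˢ univ) :=
      (continuous_fst.pow 2).continuousOn
    refine (hg1.mul hq_c).congr fun z _ => ?_
    rcases z with ⟨a, b⟩
    rfl
  have hq2 : ∀ t < (0 : ℝ), ContDiff ℝ 2 (q t) := fun t ht => by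
    have hΩ : ContDiff ℝ 2 (curl (W t)) :=
      contDiff_curl (n := 2) (analyticOnNhd_slice hWcont (bdd_of_hasTypeITimeDecay hWrate) hWmild ht).contDiff
    exact hΩ.inner ℝ hΩ
  have hQ2 : ∀ t ∈ Icc (-2 : ℝ) (-1 / 2), ContDiff ℝ 2 (Q t) := fun t ht => by
    have h : ContDiff ℝ 2 (fun y => t ^ 2 * q t y) := contDiff_const.mul (hq2 t (hslab t ht))
    exact h
  have hQt : ∀ x, ∀ t ∈ Icc (-2 : ℝ) (-1 / 2), HasDerivAt (fun τ => Q τ x) (Qt t x) t :=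
    fun x t ht => (hid t (hslab t ht) x).1
  have hlaw : ∀ t ∈ Icc (-2 : ℝ) (-1 / 2), ∀ x,
      Qt t x + fderiv ℝ (Q t) x (W t x) - (Δ (Q t)) x ≤ 0 := by
    intro t ht x
    have htn : t < 0 := hslab t ht
    have h := (hid t htn x).2
    have hP := hPW' t htn x
    have h1 : t ^ 2 * ⟪curl (W t) x, fderiv ℝ (W t) x (curl (W t) x)⟫_ℝ
        - 1 * t ^ 2 * frobeniusNormSq (fderiv ℝ (curl (W t)) x) ≤ (-t) * q t x := by
      have h2 := mul_le_mul_of_nonneg_left hP (neg_pos.2 htn).le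
      simp only [hqdef]
      nlinarith [h2]
    simp only [hQtdef, hQdef, hqdef] at h h1 ⊢
    rw [h]
    nlinarith [h1]
  have hle' : ∀ t ∈ Icc (-2 : ℝ) (-1 / 2), ∀ x, Q t x ≤ M := fun t ht x => by
    have h := hle t (hslab t ht) x
    rw [neg_sq] at h
    exact h
  have hmaxQ : Q (-1) 0 = M := by
    simp only [hQdef, hqdef, hmax]
    norm_num
  have hts : (-1 : ℝ) ∈ Ioc (-2 : ℝ) (-1 / 2) := by constructor <;> norm_num
  -- ## strong maximum principle: `Q ≡ M` on `[−2, −1) × ℝ³`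
  have hS := strongMaximumPrinciple (t₀ := (-2 : ℝ)) (T := -1 / 2) hbA hQ_c hQ2 hQt hlaw hle' hts hmaxQ
  -- ## the slice `t = −3/2`: `|curl W|² ≡ 4M/9 > 0`, infinite dissipation
  have hs₁ : (-3 / 2 : ℝ) ∈ Ico (-2 : ℝ) (-1) := by constructor <;> norm_num
  have hq₁ : ∀ x, q (-3 / 2) x = M / (-3 / 2) ^ 2 := by
    intro x
    have h := hS (-3 / 2) hs₁ x
    simp only [hQdef] at h
    rw [eq_div_iff (by norm_num)]
    linarith [h]
  have hq₁pos : 0 < M / (-3 / 2 : ℝ) ^ 2 := by positivity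
  -- the pointwise lower bound on `‖∇W‖²`
  set κ : ℝ := ‖(curlCLM : (EuclideanSpace ℝ (Fin 3) →L[ℝ] EuclideanSpace ℝ (Fin 3)) →L[ℝ]
    EuclideanSpace ℝ (Fin 3))‖ with hκ
  have hκcurl : ∀ x, ‖curl (W (-3 / 2)) x‖ ≤ κ * ‖fderiv ℝ (W (-3 / 2)) x‖ := fun x => by
    rw [curl_eq_curlCLM]; exact curlCLM.le_opNorm _
  have hκpos : 0 < κ := by
    by_contra hk
    have hk0 : κ ≤ 0 := not_lt.1 hk
    have h0 : ‖curl (W (-3 / 2)) 0‖ ≤ 0 :=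
      (hκcurl 0).trans (mul_nonpos_of_nonpos_of_nonneg hk0 (norm_nonneg _))
    have hc : curl (W (-3 / 2)) 0 = 0 := norm_le_zero_iff.1 h0
    have h := hq₁ 0
    simp only [hqdef, hc, inner_zero_left] at h
    linarith [hq₁pos]
  set c₀ : ℝ := M / (-3 / 2 : ℝ) ^ 2 / κ ^ 2 with hc₀
  have hc₀pos : 0 < c₀ := by positivity
  have hlow : ∀ x, ENNReal.ofReal c₀ ≤ ‖fderiv ℝ (W (-3 / 2)) x‖ₑ ^ 2 := by
    intro x
    have h1 : ‖curl (W (-3 / 2)) x‖ ^ 2 = M / (-3 / 2 : ℝ) ^ 2 := by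
      rw [← real_inner_self_eq_norm_sq]; exact hq₁ x
    have h2 : ‖curl (W (-3 / 2)) x‖ ^ 2 ≤ κ ^ 2 * ‖fderiv ℝ (W (-3 / 2)) x‖ ^ 2 := by
      have h := hκcurl x
      have h0 : 0 ≤ ‖curl (W (-3 / 2)) x‖ := norm_nonneg _
      nlinarith [h, h0]
    have h3 : c₀ ≤ ‖fderiv ℝ (W (-3 / 2)) x‖ ^ 2 := by
      rw [hc₀, div_le_iff₀ (pow_pos hκpos 2)]
      nlinarith [h1, h2]
    calc ENNReal.ofReal c₀ ≤ ENNReal.ofReal (‖fderiv ℝ (W (-3 / 2)) x‖ ^ 2) := ENNReal.ofReal_le_ofReal h3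
      _ = ‖fderiv ℝ (W (-3 / 2)) x‖ₑ ^ 2 := by
          rw [← ofReal_norm, ← ENNReal.ofReal_pow (norm_nonneg _)]
  have hinf : ∫⁻ x, ‖fderiv ℝ (W (-3 / 2)) x‖ₑ ^ 2 = ⊤ := by
    refine eq_top_iff.2 ?_
    calc (⊤ : ℝ≥0∞) = ∫⁻ _ : EuclideanSpace ℝ (Fin 3), ENNReal.ofReal c₀ := by
          rw [lintegral_const, measure_univ_of_isAddLeftInvariant,
            ENNReal.mul_top (ENNReal.ofReal_pos.2 hc₀pos).ne']
      _ ≤ ∫⁻ x, ‖fderiv ℝ (W (-3 / 2)) x‖ₑ ^ 2 := lintegral_mono hlow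
  have hfin := hlawW (-3 / 2) (by norm_num)
  rw [hinf, top_le_iff] at hfin
  exact ENNReal.ofReal_ne_top hfin

/-! ### Portrait clauses -/

/-- **PORTRAIT: for a non-zero finite-dissipation KNSS Type-I field, `t²|ω|²` fails to be a sub-solution
somewhere** — there is a point with `|ω|² < (−s)(⟪ω, DV ω⟫ − |∇ω|²_F)`. [cite: KochNadirashviliSereginSverak2009, Prop. 4.1 (arXiv:0709.3599)] -/
theorem subsolution_fails_of_ne_zero {K : ℝ} (hV : IsTypeIAncientMild C V)
    (hlawV : ∀ s : ℝ, s < 0 → ∫⁻ x, ‖fderiv ℝ (V s) x‖ₑ ^ 2 ≤ ENNReal.ofReal (K / Real.sqrt (-s)))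
    (hne : ∃ t : ℝ, t < 0 ∧ ∃ x, V t x ≠ 0) :
    ∃ s : ℝ, s < 0 ∧ ∃ y : EuclideanSpace ℝ (Fin 3),
      ⟪curl (V s) y, curl (V s) y⟫_ℝ < (-s) * (⟪curl (V s) y, fderiv ℝ (V s) y (curl (V s) y)⟫_ℝ
        - frobeniusNormSq (fderiv ℝ (curl (V s)) y)) := by
  by_contra h
  push Not at h
  obtain ⟨t, ht, x, hx⟩ := hne
  exact hx (eq_zero_of_enstrophy_subsolution_of_law hV hlawV
    (fun s hs y => by rw [one_mul]; exact h s hs y) t ht x)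

/-- **PORTRAIT (singular form)**: a finite-dissipation KNSS Type-I field singular at the space-time origin has a
point with `|ω|² < (−s)(⟪ω, DV ω⟫ − |∇ω|²_F)`. [cite: KochNadirashviliSereginSverak2009, Prop. 4.1 (arXiv:0709.3599)] -/
theorem subsolution_fails_of_singular {K : ℝ} (hV : IsTypeIAncientMild C V)
    (hlawV : ∀ s : ℝ, s < 0 → ∫⁻ x, ‖fderiv ℝ (V s) x‖ₑ ^ 2 ≤ ENNReal.ofReal (K / Real.sqrt (-s)))
    (hsing : ∀ r > 0, ∀ M : ℝ, ∃ t ∈ Ioo (-(r ^ 2)) (0 : ℝ),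
        ∃ x ∈ ball (0 : EuclideanSpace ℝ (Fin 3)) r, M < ‖V t x‖) :
    ∃ s : ℝ, s < 0 ∧ ∃ y : EuclideanSpace ℝ (Fin 3),
      ⟪curl (V s) y, curl (V s) y⟫_ℝ < (-s) * (⟪curl (V s) y, fderiv ℝ (V s) y (curl (V s) y)⟫_ℝ
        - frobeniusNormSq (fderiv ℝ (curl (V s)) y)) := by
  refine subsolution_fails_of_ne_zero hV hlawV ?_
  obtain ⟨t, ht, x, -, hM⟩ := hsing 1 one_pos 0
  exact ⟨t, ht.2, x, fun h0 => by rw [h0, norm_zero] at hM; exact lt_irrefl _ hM⟩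

end Summit.NavierStokesRegularity.NavierStokesRegularity.Theorems.FiniteDissipationLiouville.CriticalProduction

end
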